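import Summits.QuantumFields.GaugeBoot.PeriodicPlaquetteInsertion
import Summits.QuantumFields.GaugeBoot.TiltedLatticeHaarShift
import Summits.QuantumFields.GaugeBoot.SchwingerDysonPair
import HarnessLib

/-!
# The differentiated one-link Schwinger–Dyson identity on a periodic lattice: pair form and polarisation (gauge-boot, periodic loop equations 4/5)

HONEST FRAMING (cell `pub-gaugeboot`, page 1 of every file): the venture produces certified bounds
on lattice expectations at stated coupling, gauge group, dimension and torus size; NOT a mass gap,
NOT a continuum limit, NOT a string tension; NOT Yang–Mills-summit-bearing (barriers
`FixedCouplingUltralocality`, `PerturbativeInvisibility`).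

File 4/5 of the re-typing of the tree's loop-equation stack over the periodic lattice `(A, e)` of
`TiltedLatticeGauge.lean` (Wilson measure `μ_β = gibbs ρ e β`); the analogue of the torus files
`…YangMills/Theorems/ScalingWindowSplitCurvatureAmnesiaWilsonSchwingerDyson.lean` and
`SchwingerDysonPair.lean` (whose matrix-only pieces `traceMulLeftCLM`, `conjTranspose_skewPart`,
`conjTranspose_iHermPart`, `eq_skewPart_add`, `trace_parts_eq_zero` are reused):

* **`integral_shiftDeriv_eq_gibbs`** — the DIFFERENTIATED one-link Haar-shift identity: for a
  multiplicative family `k : ℝ → G`, a real observable `f` continuous with a continuous derivative `f'`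
  along the left shift `U ↦ U[l ↦ k(t)U_l]` at `t = 0`, and `S'` a continuous derivative of the Wilson
  action along the same shift, `∫ f' dμ_β = β ∫ f S' dμ_β` (compact second countable `G`, continuous
  `ρ`, every real `β`). Proof: differentiate the integrated identity
  `TiltedLatticeHaarShift.integral_comp_update_mul_gibbs` at `t = 0` under the integral sign on both
  sides (bounded Lipschitz families on the compact configuration space). This is tribunal item A13:
  the derivative along `g = exp(tX)` of the one-link Gibbs identity, on the periodic-lattice type.
* `integral_shiftDeriv_eq_gibbs_complex`; **`sd_pair`** — for a lattice representation `r`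
  (`LatticeRep`: faithful continuous unitary), an admissible direction `X` (skew-Hermitian, generating
  a one-parameter subgroup through `r.ρ`), ANY matrix `Y`, any word `w` from `x₀` and the link
  `(x, μ)`: `∫ tr(Y·insDeriv_X hol_w) dμ_β = β ∫ tr(Y·ρ(hol_w))·(−½ plaqIns_X) dμ_β`;
* `SDPair` (the identity as a predicate in `X`) and POLARISATION (`sdPair_of_parts/traceless/skew`).

Everything is `[folklore]`. `A, G : Type` (the measure-theoretic helper lemmas of the torus files
are universe-monomorphic).

References: M. Creutz, *Quarks, gluons and lattices* (1983) Ch. 11; S. Chatterjee, arXiv:1502.07719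
§3; S. Cao, M. Park, S. Sheffield, Comm. AMS 5 (2025),
Thm. 5.7 (`U(N)`) / Thm. 6.104 (`SU(N)`) (arXiv:2307.06790 numbering; informally Thm. 1.14); V. Kazakov, Z. Zheng,
arXiv:2203.11360 §2.
-/

noncomputable section

open MeasureTheory Filter Topology NormedSpace
open scoped Matrix.Norms.Frobenius Matrix
open Literature.MathematicalPhysics.QuantumFieldTheory (LatticeRep)
open Summit.QuantumFields.YangMills.Theorems.EquipartitionPinsProbe.TangentSteinFiniteBeta
  (lipschitz_of_flow abs_exp_sub_exp_le exists_abs_le_of_continuous)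
open Summit.QuantumFields.YangMills.Theorems.EquipartitionPinsProbe.TangentDiffIdentity
  (hasDerivAt_integral_of_bounded_lipschitz)
open Summit.QuantumFields.YangMills.Cruxes.CurvatureAmnesia.WardDefect.SchwingerDyson (oneParam_neg)

namespace Summit.QuantumFields.GaugeBoot

namespace TiltedRP

variable {A : Type} [AddCommGroup A] [DecidableEq A] [Fintype A] {d N : ℕ} {G : Type} [Group G]
  [TopologicalSpace G] [IsTopologicalGroup G] [CompactSpace G] [MeasurableSpace G] [BorelSpace G]

/-! ### The differentiated one-link Haar-shift identity -/

section Identity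

variable [SecondCountableTopology G] (ρ : G →* Matrix (Fin N) (Fin N) ℂ)

/-- **One-link Schwinger–Dyson (integration-by-parts) identity for the Wilson measure of a periodic
lattice.** For compact second countable `G`, continuous `ρ`, the lattice `(A, e)`, a real coupling
`β`, a link `l` and a multiplicative family `k : ℝ → G`: if the real observable `f` is continuous with
a continuous derivative `f'` along the left shift `U ↦ U[l ↦ k(t)U_l]` at `t = 0`, and `S'` is a
continuous derivative of the Wilson action along the same shift, then `∫ f' dμ_β = β ∫ f S' dμ_β`.
Proof: differentiate `integral_comp_update_mul_gibbs` at `t = 0` under the integral sign.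
[folklore] -/
theorem integral_shiftDeriv_eq_gibbs (hρ : Continuous ρ) (e : Fin d → A) (β : ℝ) (l : Link A d)
    {k : ℝ → G} (hk : ∀ s t, k (s + t) = k s * k t)
    (f f' : Config A d G → ℝ) (hf : Continuous f) (hf'c : Continuous f')
    (hf' : ∀ U, HasDerivAt (fun t => f (Function.update U l (k t * U l))) (f' U) 0)
    (S' : Config A d G → ℝ) (hS'c : Continuous S')
    (hS' : ∀ U, HasDerivAt (fun t => wilsonAction ρ e (Function.update U l (k t * U l))) (S' U) 0) :
    ∫ U, f' U ∂(gibbs ρ e β) = β * ∫ U, f U * S' U ∂(gibbs ρ e β) := by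
  haveI := isProbabilityMeasure_gibbs ρ hρ e β
  set μ := gibbs ρ e β with hμ
  set S := wilsonAction (A := A) (d := d) (G := G) ρ e with hSdef
  set T : ℝ → Config A d G → Config A d G := fun t U => Function.update U l (k t * U l) with hT
  have hflow : ∀ s t U, T (t + s) U = T t (T s U) := fun s t U => update_shift_flow hk l s t U
  have hT0 : ∀ U, T 0 U = U := fun U => update_shift_zero hk l U
  have hTc : ∀ t, Continuous (T t) := fun t => continuous_update_shift l (k t)
  have hf'T : ∀ U, HasDerivAt (fun t => f (T t U)) (f' U) 0 := hf'
  have hS'T : ∀ U, HasDerivAt (fun t => S (T t U)) (S' U) 0 := hS'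
  obtain ⟨Cf, hCf0, hCf⟩ := exists_abs_le_of_continuous hf
  obtain ⟨Cf', -, hCf'⟩ := exists_abs_le_of_continuous hf'c
  obtain ⟨CS', hCS'0, hCS'⟩ := exists_abs_le_of_continuous hS'c
  have hSc : Continuous S := continuous_wilsonAction ρ hρ e
  obtain ⟨CS, -, hCS⟩ := exists_abs_le_of_continuous hSc
  -- the two sides of the finite-shift identity, as functions of `t`
  have hAB : ∀ t : ℝ, ∫ U, f (T t U) ∂μ = ∫ U, f U * Real.exp (-(β * (S (T (-t) U) - S U))) ∂μ := by
    intro t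
    have h := integral_comp_update_mul_gibbs ρ e β l (k t) f
    rw [← oneParam_neg hk t] at h
    exact h
  -- derivative of the left side
  have hAd : HasDerivAt (fun t : ℝ => ∫ U, f (T t U) ∂μ) (∫ U, f' U ∂μ) 0 := by
    refine hasDerivAt_integral_of_bounded_lipschitz μ (fun t U => f (T t U)) f' (Cf + Cf')
      (fun t => (hf.comp (hTc t)).measurable) hf'c.measurable
      (fun t U => (hCf _).trans (le_add_of_nonneg_right ?_)) (fun U t s => ?_) hf'T
    · exact (abs_nonneg _).trans (hCf' U)
    · calc |f (T t U) - f (T s U)| ≤ Cf' * |t - s| := lipschitz_of_flow T hflow f f' hf'T hCf' U t s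
        _ ≤ (Cf + Cf') * |t - s| := by gcongr; linarith [(abs_nonneg _).trans (hCf U)]
  -- derivative of the right side
  have hBd : HasDerivAt (fun t : ℝ => ∫ U, f U * Real.exp (-(β * (S (T (-t) U) - S U))) ∂μ)
      (∫ U, f U * (β * S' U) ∂μ) 0 := by
    set M := |β| * (2 * CS) with hMdef
    have hM : ∀ t U, -(β * (S (T (-t) U) - S U)) ≤ M := fun t U => by
      have h1 := hCS (T (-t) U)
      have h2 := hCS U
      calc -(β * (S (T (-t) U) - S U)) ≤ |β * (S (T (-t) U) - S U)| := neg_le_abs _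
        _ = |β| * |S (T (-t) U) - S U| := abs_mul _ _
        _ ≤ |β| * (2 * CS) := by
            gcongr
            calc |S (T (-t) U) - S U| ≤ |S (T (-t) U)| + |S U| := abs_sub _ _
              _ ≤ CS + CS := add_le_add h1 h2
              _ = 2 * CS := by ring
    have hE : ∀ t U, |Real.exp (-(β * (S (T (-t) U) - S U)))| ≤ Real.exp M := fun t U => by
      rw [abs_of_pos (Real.exp_pos _)]
      exact Real.exp_le_exp.2 (hM t U)
    have hSlip : ∀ U t s, |S (T (-t) U) - S (T (-s) U)| ≤ CS' * |t - s| := fun U t s => by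
      have h := lipschitz_of_flow T hflow S S' hS'T hCS' U (-t) (-s)
      rwa [show |(-t) - (-s)| = |t - s| by rw [neg_sub_neg, abs_sub_comm]] at h
    refine hasDerivAt_integral_of_bounded_lipschitz μ
      (fun t U => f U * Real.exp (-(β * (S (T (-t) U) - S U)))) (fun U => f U * (β * S' U))
      (Cf * Real.exp M + Cf * (Real.exp M * (|β| * CS'))) (fun t => ?_) ?_ (fun t U => ?_)
      (fun U t s => ?_) (fun U => ?_)
    · exact (hf.mul (Real.continuous_exp.comp
        (((hSc.comp (hTc (-t))).sub hSc).const_mul β).neg)).measurable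
    · exact (hf.mul (hS'c.const_mul β)).measurable
    · calc |f U * Real.exp (-(β * (S (T (-t) U) - S U)))|
          = |f U| * |Real.exp (-(β * (S (T (-t) U) - S U)))| := abs_mul _ _
        _ ≤ Cf * Real.exp M := mul_le_mul (hCf U) (hE t U) (abs_nonneg _) hCf0
        _ ≤ Cf * Real.exp M + Cf * (Real.exp M * (|β| * CS')) := le_add_of_nonneg_right (by positivity)
    · have hx : -(β * (S (T (-t) U) - S U)) ≤ M := hM t U
      have hy : -(β * (S (T (-s) U) - S U)) ≤ M := hM s U
      calc |f U * Real.exp (-(β * (S (T (-t) U) - S U))) - f U * Real.exp (-(β * (S (T (-s) U) - S U)))|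
          = |f U| * |Real.exp (-(β * (S (T (-t) U) - S U))) -
              Real.exp (-(β * (S (T (-s) U) - S U)))| := by rw [← mul_sub, abs_mul]
        _ ≤ Cf * (Real.exp M * |(-(β * (S (T (-t) U) - S U))) - (-(β * (S (T (-s) U) - S U)))|) :=
            mul_le_mul (hCf U) (abs_exp_sub_exp_le hx hy) (abs_nonneg _) hCf0
        _ = Cf * (Real.exp M * (|β| * |S (T (-t) U) - S (T (-s) U)|)) := by
            rw [show -(β * (S (T (-t) U) - S U)) - -(β * (S (T (-s) U) - S U)) =
              -(β * (S (T (-t) U) - S (T (-s) U))) by ring, abs_neg, abs_mul]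
        _ ≤ Cf * (Real.exp M * (|β| * (CS' * |t - s|))) := by gcongr; exact hSlip U t s
        _ = Cf * (Real.exp M * (|β| * CS')) * |t - s| := by ring
        _ ≤ (Cf * Real.exp M + Cf * (Real.exp M * (|β| * CS'))) * |t - s| := by
            have : 0 ≤ Cf * Real.exp M * |t - s| := by positivity
            nlinarith [this]
    · have hSneg : HasDerivAt (fun t : ℝ => S (T (-t) U)) (-(S' U)) 0 := by
        have h0 : HasDerivAt (fun t : ℝ => S (T t U)) (S' U) (-0) := by rw [neg_zero]; exact hS'T U
        have h := h0.scomp (0 : ℝ) (hasDerivAt_neg (0 : ℝ))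
        simpa [Function.comp_def] using h
      have hin : HasDerivAt (fun t : ℝ => -(β * (S (T (-t) U) - S U))) (β * S' U) 0 := by
        exact (((hSneg.sub_const (S U)).const_mul β).neg).congr_deriv (by ring)
      have hexp := hin.exp
      have h0 : -(β * (S (T (-0) U) - S U)) = 0 := by rw [neg_zero, hT0, sub_self, mul_zero, neg_zero]
      rw [h0, Real.exp_zero, one_mul] at hexp
      exact hexp.const_mul (f U)
  -- the two sides agree, hence so do their derivatives
  have hEq : (fun t : ℝ => ∫ U, f (T t U) ∂μ) =
      fun t : ℝ => ∫ U, f U * Real.exp (-(β * (S (T (-t) U) - S U))) ∂μ := funext hAB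
  rw [hEq] at hAd
  rw [hAd.unique hBd, ← integral_const_mul]
  refine integral_congr_ae (ae_of_all _ fun U => ?_)
  ring

end Identity

/-! ### Lattice representations: complex observables and the pair identity -/

section SDPair

variable (r : LatticeRep G) (e : Fin d → A)

omit [DecidableEq A] in
/-- Continuous (complex) observables on the compact configuration space are integrable for the Wilson
measure of the periodic lattice (given the faithful representation `r`, which makes `G` second
countable). [folklore] -/
theorem integrable_of_continuous_gibbs (β : ℝ) {F : Config A d G → ℂ} (hF : Continuous F) :
    Integrable F (gibbs r.ρ e β) := by
  haveI : SecondCountableTopology G :=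
    (r.continuous.isClosedEmbedding r.injective).isEmbedding.secondCountableTopology
  haveI := isProbabilityMeasure_gibbs r.ρ r.continuous e β
  obtain ⟨C, hC⟩ := isCompact_univ.exists_bound_of_continuousOn hF.continuousOn
  exact Integrable.of_bound hF.measurable.aestronglyMeasurable C (ae_of_all _ fun U => hC U (Set.mem_univ U))

/-- **Complex-valued one-link Schwinger–Dyson identity** on the periodic lattice (real and imaginary
parts of `integral_shiftDeriv_eq_gibbs`). [folklore] -/
theorem integral_shiftDeriv_eq_gibbs_complex (β : ℝ) (l : Link A d) {k : ℝ → G}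
    (hk : ∀ s t, k (s + t) = k s * k t) (f f' : Config A d G → ℂ) (hf : Continuous f)
    (hf'c : Continuous f')
    (hf' : ∀ U, HasDerivAt (fun t => f (Function.update U l (k t * U l))) (f' U) 0)
    (S' : Config A d G → ℝ) (hS'c : Continuous S')
    (hS' : ∀ U, HasDerivAt (fun t => wilsonAction r.ρ e (Function.update U l (k t * U l))) (S' U) 0) :
    ∫ U, f' U ∂(gibbs r.ρ e β) = (β : ℂ) * ∫ U, f U * (S' U : ℂ) ∂(gibbs r.ρ e β) := by
  haveI : SecondCountableTopology G :=
    (r.continuous.isClosedEmbedding r.injective).isEmbedding.secondCountableTopology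
  have hre := integral_shiftDeriv_eq_gibbs r.ρ r.continuous e β l hk (fun U => (f U).re)
    (fun U => (f' U).re) (Complex.continuous_re.comp hf) (Complex.continuous_re.comp hf'c)
    (fun U => by simpa [Function.comp_def] using (Complex.reCLM.hasFDerivAt.comp_hasDerivAt (0 : ℝ) (hf' U)))
    S' hS'c hS'
  have him := integral_shiftDeriv_eq_gibbs r.ρ r.continuous e β l hk (fun U => (f U).im)
    (fun U => (f' U).im) (Complex.continuous_im.comp hf) (Complex.continuous_im.comp hf'c)
    (fun U => by simpa [Function.comp_def] using (Complex.imCLM.hasFDerivAt.comp_hasDerivAt (0 : ℝ) (hf' U)))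
    S' hS'c hS'
  have hi1 : Integrable f' (gibbs r.ρ e β) := integrable_of_continuous_gibbs r e β hf'c
  have hi2 : Integrable (fun U => f U * (S' U : ℂ)) (gibbs r.ρ e β) :=
    integrable_of_continuous_gibbs r e β (hf.mul (Complex.continuous_ofReal.comp hS'c))
  apply Complex.ext
  · have h1 := Complex.reCLM.integral_comp_comm hi1
    have h2 := Complex.reCLM.integral_comp_comm hi2
    simp only [Complex.reCLM_apply, Complex.mul_re, Complex.ofReal_re, Complex.ofReal_im, mul_zero,
      sub_zero] at h1 h2
    rw [← h1, hre, Complex.re_ofReal_mul, ← h2]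
  · have h1 := Complex.imCLM.integral_comp_comm hi1
    have h2 := Complex.imCLM.integral_comp_comm hi2
    simp only [Complex.imCLM_apply, Complex.mul_im, Complex.ofReal_re, Complex.ofReal_im, mul_zero,
      zero_add] at h1 h2
    rw [← h1, him, Complex.im_ofReal_mul, ← h2]

/-- **The one-link Schwinger–Dyson identity for a word on a periodic lattice (pair form).** For an
admissible direction `X` (skew-Hermitian, `r.ρ(k t) = exp(tX)` for a one-parameter subgroup `k`), ANY
matrix `Y`, any word `w` read from `x₀`, and the link `(x, μ)`:
`∫ tr(Y·insDeriv_X hol_w) dμ_β = β ∫ tr(Y·ρ(hol_w)) · (−½ plaqIns_X) dμ_β`. [folklore] -/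
theorem sd_pair (β : ℝ) (x : A) (μ : Fin d) {k : ℝ → G} (hk : ∀ s t, k (s + t) = k s * k t)
    {X : Matrix (Fin r.N) (Fin r.N) ℂ} (hX : ∀ t, r.ρ (k t) = exp ((t : ℂ) • X)) (hXs : Xᴴ = -X)
    (Y : Matrix (Fin r.N) (Fin r.N) ℂ) (x₀ : A) (w : Word d) :
    ∫ U, (Y * insDeriv r.ρ e (x, μ) X U x₀ w).trace ∂(gibbs r.ρ e β) =
      (β : ℂ) * ∫ U, (Y * r.ρ (wordHolonomy e U x₀ w)).trace * (-(1 / 2) * plaqIns r.ρ e X U x μ)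
        ∂(gibbs r.ρ e β) := by
  have h := integral_shiftDeriv_eq_gibbs_complex r e β (x, μ) hk
    (fun U => (Y * r.ρ (wordHolonomy e U x₀ w)).trace) (fun U => (Y * insDeriv r.ρ e (x, μ) X U x₀ w).trace)
    ((continuous_const.mul (r.continuous.comp (continuous_wordHolonomy e x₀ w))).matrix_trace)
    ((continuous_const.mul (continuous_insDeriv e (x, μ) r.continuous x₀ w)).matrix_trace)
    (fun U => by
      have hd := (traceMulLeftCLM Y).hasFDerivAt.comp_hasDerivAt (0 : ℝ)
        (hasDerivAt_wordHolonomy e (x, μ) hk hX U x₀ w)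
      simpa [Function.comp_def] using hd.congr_deriv (traceMulLeftCLM_apply Y _))
    (actionDeriv r.ρ e (x, μ) X) (continuous_actionDeriv e (x, μ) r.continuous)
    (fun U => hasDerivAt_wilsonAction e (x, μ) hk hX U)
  rw [h]
  congr 1
  refine integral_congr_ae (ae_of_all _ fun U => ?_)
  simp only [actionDeriv_eq_plaqIns e hXs r.mem_unitary U x μ]

end SDPair

/-! ### Polarisation -/

section Polarisation

variable (r : LatticeRep G) (e : Fin d → A)

omit [Fintype A] [CompactSpace G] [MeasurableSpace G] [BorelSpace G] in
/-- Continuity of `U ↦ tr(Y·insDeriv)`. [folklore] -/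
theorem continuous_trace_mul_insDeriv (Y X : Matrix (Fin r.N) (Fin r.N) ℂ) (l : Link A d) (x₀ : A)
    (w : Word d) : Continuous fun U : Config A d G => (Y * insDeriv r.ρ e l X U x₀ w).trace :=
  (continuous_const.mul (continuous_insDeriv e l r.continuous x₀ w)).matrix_trace

omit [DecidableEq A] [Fintype A] [CompactSpace G] [MeasurableSpace G] [BorelSpace G] in
/-- Continuity of `U ↦ plaqIns`. [folklore] -/
theorem continuous_plaqIns (X : Matrix (Fin r.N) (Fin r.N) ℂ) (x : A) (μ : Fin d) :
    Continuous fun U : Config A d G => plaqIns r.ρ e X U x μ := by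
  unfold plaqIns
  refine continuous_finsetSum _ fun ν _ => continuous_finsetSum _ fun ε _ => ?_
  exact (continuous_const.mul ((r.continuous.comp (continuous_wordHolonomy e x _)).sub
    (r.continuous.comp (continuous_wordHolonomy e x _)))).matrix_trace

omit [DecidableEq A] [Fintype A] [CompactSpace G] [MeasurableSpace G] [BorelSpace G] in
/-- Continuity of the right-hand integrand `tr(Y ρ(hol_w))·(−½ plaqIns)`. [folklore] -/
theorem continuous_rhsIntegrand (Y X : Matrix (Fin r.N) (Fin r.N) ℂ) (x : A) (μ : Fin d) (x₀ : A)
    (w : Word d) : Continuous fun U : Config A d G =>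
      (Y * r.ρ (wordHolonomy e U x₀ w)).trace * (-(1 / 2) * plaqIns r.ρ e X U x μ) :=
  (continuous_const.mul (r.continuous.comp (continuous_wordHolonomy e x₀ w))).matrix_trace.mul
    (continuous_const.mul (continuous_plaqIns r e X x μ))

/-- THE PAIR IDENTITY for the direction `X` on the periodic lattice (word `w` from `x₀`, link
`(x, μ)`, coupling `β`): for every `Y`,
`∫ tr(Y·insDeriv_X hol_w) dμ_β = β ∫ tr(Y ρ(hol_w))·(−½ plaqIns_X) dμ_β`. [shape] A parametric
definition of a proposition organising the proof — NOT a named fact. [folklore] -/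
def SDPair (β : ℝ) (x : A) (μ : Fin d) (x₀ : A) (w : Word d) (X : Matrix (Fin r.N) (Fin r.N) ℂ) : Prop :=
  ∀ Y : Matrix (Fin r.N) (Fin r.N) ℂ,
    ∫ U, (Y * insDeriv r.ρ e (x, μ) X U x₀ w).trace ∂(gibbs r.ρ e β) =
      (β : ℂ) * ∫ U, (Y * r.ρ (wordHolonomy e U x₀ w)).trace * (-(1 / 2) * plaqIns r.ρ e X U x μ)
        ∂(gibbs r.ρ e β)

/-- `sd_pair` restated: admissible skew-Hermitian directions satisfy the pair identity. [folklore] -/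
theorem sdPair_of_oneParam (β : ℝ) (x : A) (μ : Fin d) (x₀ : A) (w : Word d)
    {X : Matrix (Fin r.N) (Fin r.N) ℂ} (hXs : Xᴴ = -X) {k : ℝ → G} (hk : ∀ s t, k (s + t) = k s * k t)
    (hX : ∀ t, r.ρ (k t) = exp ((t : ℂ) • X)) : SDPair r e β x μ x₀ w X :=
  fun Y => sd_pair r e β x μ hk hX hXs Y x₀ w

/-- **Polarisation step**: the pair identity for the two skew-Hermitian parts of `X` implies it for `X`
(both sides are `ℂ`-linear in `X`). [folklore] -/
theorem sdPair_of_parts (β : ℝ) (x : A) (μ : Fin d) (x₀ : A) (w : Word d)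
    (X : Matrix (Fin r.N) (Fin r.N) ℂ) (hPA : SDPair r e β x μ x₀ w ((1 / 2 : ℂ) • (X - Xᴴ)))
    (hPB : SDPair r e β x μ x₀ w ((Complex.I / 2) • (X + Xᴴ))) : SDPair r e β x μ x₀ w X := by
  set A₁ : Matrix (Fin r.N) (Fin r.N) ℂ := (1 / 2 : ℂ) • (X - Xᴴ) with hA
  set B₁ : Matrix (Fin r.N) (Fin r.N) ℂ := (Complex.I / 2) • (X + Xᴴ) with hB
  have hXAB : X = A₁ + (-Complex.I) • B₁ := eq_skewPart_add X
  clear_value A₁ B₁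
  intro Y
  have hiA := integrable_of_continuous_gibbs r e β (continuous_trace_mul_insDeriv r e Y A₁ (x, μ) x₀ w)
  have hiB := integrable_of_continuous_gibbs r e β (continuous_trace_mul_insDeriv r e Y B₁ (x, μ) x₀ w)
  have hjA := integrable_of_continuous_gibbs r e β (continuous_rhsIntegrand r e Y A₁ x μ x₀ w)
  have hjB := integrable_of_continuous_gibbs r e β (continuous_rhsIntegrand r e Y B₁ x μ x₀ w)
  have hl : ∀ U : Config A d G, (Y * insDeriv r.ρ e (x, μ) X U x₀ w).trace =
      (Y * insDeriv r.ρ e (x, μ) A₁ U x₀ w).trace +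
        (-Complex.I) * (Y * insDeriv r.ρ e (x, μ) B₁ U x₀ w).trace := by
    intro U
    rw [hXAB, insDeriv_add, insDeriv_smul, Matrix.mul_add, Matrix.mul_smul, Matrix.trace_add,
      Matrix.trace_smul, smul_eq_mul]
  have hr : ∀ U : Config A d G,
      (Y * r.ρ (wordHolonomy e U x₀ w)).trace * (-(1 / 2) * plaqIns r.ρ e X U x μ) =
        (Y * r.ρ (wordHolonomy e U x₀ w)).trace * (-(1 / 2) * plaqIns r.ρ e A₁ U x μ) +
          (-Complex.I) * ((Y * r.ρ (wordHolonomy e U x₀ w)).trace *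
            (-(1 / 2) * plaqIns r.ρ e B₁ U x μ)) := by
    intro U
    rw [hXAB, plaqIns_add, plaqIns_smul]
    ring
  simp_rw [hl, hr]
  rw [integral_add hiA (hiB.const_mul _), integral_const_mul, integral_add hjA (hjB.const_mul _),
    integral_const_mul, hPA Y, hPB Y]
  ring

/-- **Polarisation (`𝔰𝔲`-type).** If every traceless skew-Hermitian direction satisfies the pair
identity, so does every traceless direction. [folklore] -/
theorem sdPair_of_traceless (β : ℝ) (x : A) (μ : Fin d) (x₀ : A) (w : Word d)
    (hadm : ∀ X : Matrix (Fin r.N) (Fin r.N) ℂ, Xᴴ = -X → X.trace = 0 → SDPair r e β x μ x₀ w X)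
    (X : Matrix (Fin r.N) (Fin r.N) ℂ) (hX : X.trace = 0) : SDPair r e β x μ x₀ w X :=
  sdPair_of_parts r e β x μ x₀ w X (hadm _ (conjTranspose_skewPart X) (trace_parts_eq_zero hX _).1)
    (hadm _ (conjTranspose_iHermPart X) (trace_parts_eq_zero hX _).2)

/-- **Polarisation (`𝔲`-type).** If every skew-Hermitian direction satisfies the pair identity, so
does every direction. [folklore] -/
theorem sdPair_of_skew (β : ℝ) (x : A) (μ : Fin d) (x₀ : A) (w : Word d)
    (hadm : ∀ X : Matrix (Fin r.N) (Fin r.N) ℂ, Xᴴ = -X → SDPair r e β x μ x₀ w X)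
    (X : Matrix (Fin r.N) (Fin r.N) ℂ) : SDPair r e β x μ x₀ w X :=
  sdPair_of_parts r e β x μ x₀ w X (hadm _ (conjTranspose_skewPart X)) (hadm _ (conjTranspose_iHermPart X))

end Polarisation

end TiltedRP

end Summit.QuantumFields.GaugeBoot

end
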